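import Summits.QuantumFields.YangMills.Theorems.SwapVirialDeficitBlowUpGnomonicTrLetterFloors
import Summits.QuantumFields.YangMills.Theorems.SwapVirialDeficitSectorLaplaceBTubeCapFarFloorLambdaB
import Summits.QuantumFields.YangMills.Theorems.SwapVirialDeficitBlowUpGnomonicFibreFarFloor
import HarnessLib

/-!
# THE GLOBAL FLOOR OF SECTOR `001` IN THE TRANSLATED CHART and its FAR FLOOR — one region, ALL hubs, no cut: `min(‖fibre′‖², 1) ≤ 10816·(1+|Fol L|)·L⁶·F̂₁`
# (inputs (iii)/(v) of `stub_h001_good`, skeleton ➎ v8; free-hands support of ⟨stmt-QuantumFields-24197⟩ `SwapVirialDeficit.SwapGluedStiffness`; LEAD sfw-p2 g99 21:44Z)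

The 001 valley `B₀₀₁` (fcl-p3 g47 ✓`trGnoDeficit_001_flat_eq_zero`: hub-polar `δ = 0`, `x = t·(0, 1, −y₀)`, `y = (y₀, 0, 0)`, `z = 0`, followers `0`) read at the hub
`hubAt δ 1` has BASE letters `y₀` and `v = (x₁ − y₀x₂)/√(1+y₀²)` and FIBRE letters `δ`, `x₀`, `w/√(1+y₀²)` (`w = x₁y₀ + x₂`), `y⊥ = (y₁, y₂)`, `z`, `η_F`.
The letter floors of ✓`…TrLetterFloors` (twisted anticommutator ⟹ `y⊥`, `δ`; `[x̂, Y′]` ⟹ `w`, `x₀`; `σ0` ⟹ `z`; followers) combine, by pure real arithmetic, into ONE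
global inequality in the RESCALED fibre letters `x-fibre/√(1+v²)`, `y⊥/√(1+y₀²)` (the gnomonic Jacobian scalings under which the valley is uniformly non-degenerate:
main-term base weight `(1+v²)⁻¹(1+y₀²)⁻¹`, integrable):
* `min_add_le_add_min` (`min(a+b,1) ≤ min(a,1) + min(b,1)`), `bfar_tr_scalar` (the scalar heart: two cases on `|y⊥|² ≷ 1 + y₀²`);
* ★★★ `tr001_global_floor (δ : ℝ) (ε) (η) : min (δ² + ((1+y₀²)x₀² + w²)/((1+y₀²) + v′²) + |y⊥|²/(1+y₀²) + |z|² + Σ_f|η_f|²) 1 ≤ 10816·(1 + |Fol L|)·L⁶·F̂₁`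
  (`v′ = x₁ − y₀x₂`, `w = x₁y₀ + x₂`; `F̂₁ = trGnoDeficit uJ z₁ (sectorChar z₁) (hubAt δ 1) ε η`) — EVERY `δ ∈ ℝ` (the whole hub chart: the 001 region is ONE region,
  LEAD memo7 §D), EVERY sign pattern, ALL coordinates;
* ★★★ `tr001_far_floor (δ R : ℝ) (hR0 : 0 ≤ R) (hR1 : R ≤ 1) (ε) (η) (hfar : R² ≤ <the same rescaled fibre norm²>) : R²/(10816·(1+|Fol L|)·L⁶) ≤ F̂₁` — the far-floor
  socket of the 001 fibred Laplace law in whatever composite chart fcl-p3 g48 builds on these base/fibre letters (no `τ`, no cap: polynomial in `L` only).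

HONEST LABEL: real arithmetic on landed inequalities; the 001 chart equivalence (g48), the 001 law and `stub_h001_good`, stubs B (closing) ∕ core-tip ∕ core-end, ⟨24197⟩ ∕
⟨24194⟩ and every rung are OPEN; own crux ⟨22884⟩ `LargeFieldMassRefinementTail` OPEN (blocked-on ⟨19935⟩); no crux, rung of record or summit is proved; the Yang–Mills
mass gap is NOT proved; no summit is proved by a line.  THEOREMS ONLY (0 `def`, 0 `sorry`), standard axioms.  Width seat ym-line-sfw-p2-w3 g67 (cell ym-idea-1, free hands),
`--supports stmt-QuantumFields-24197`.  References: [cite: Luscher1983, §2]; [cite: tHooft1979]; [folklore].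
-/

set_option autoImplicit false

noncomputable section

open MeasureTheory Quaternion
open scoped BigOperators Quaternion
open Literature.MathematicalPhysics.QuantumFieldTheory hiding SU2
open Literature.MathematicalPhysics.QuantumLattice

namespace Summit.QuantumFields.YangMills.Theorems.SwapVirialDeficit.BlowUpRing

open Summit.QuantumFields.YangMills.Theorems.FemtoTransferGap
open Summit.QuantumFields.YangMills.Theorems.FemtoTransferGap.TT
open Summit.QuantumFields.YangMills.Theorems.VirialFluxGap.RingDeficit
open Summit.QuantumFields.YangMills.Theorems.SwapVirialDeficit.SwapRing
open Summit.QuantumFields.YangMills.Theorems.SwapVirialDeficit.SectorLaplace (z₁ uJ sectorChar)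

variable {L : ℕ} [NeZero L]

/-! ## §1 Scalar lemmas -/
set_option maxHeartbeats 400000 in
omit [NeZero L] in
/-- ★ **THE SCALAR HEART OF THE 001 GLOBAL FLOOR**: from the four letter floors (as real inequalities, `M = L⁶`, `N = |Fol L|`),
`min(δ² + ((1+y₀²)x₀² + w²)/((1+y₀²)+v′²) + |y⊥|²/(1+y₀²) + S_z + S_F, 1) ≤ 10816·(1+N)·M·F`. [folklore] -/
theorem bfar_tr_scalar {δ x₀ x₁ x₂ y₀ y₁ y₂ Sz SF Φ M N F : ℝ} (hM : 0 < M) (hN : 0 ≤ N) (hF : 0 ≤ F) (hSz : 0 ≤ Sz) (hSF : 0 ≤ SF)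
    (fs2 : 4 * (y₁ ^ 2 + y₂ ^ 2) / (1 + (y₀ ^ 2 + y₁ ^ 2 + y₂ ^ 2)) + 4 * δ ^ 2 * (1 + y₀ ^ 2) / ((1 + δ ^ 2) * (1 + (y₀ ^ 2 + y₁ ^ 2 + y₂ ^ 2))) ≤ 1352 * M * F)
    (fc : 4 * ((x₁ * y₀ + x₂) ^ 2 + (x₂ * y₂ + x₀ * y₀) ^ 2 + (x₀ - x₁ * y₂) ^ 2) / ((1 + (x₀ ^ 2 + x₁ ^ 2 + x₂ ^ 2)) * (1 + (y₀ ^ 2 + y₁ ^ 2 + y₂ ^ 2))) ≤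
      1352 * M * F)
    (fz : Sz / (1 + Sz) ≤ 1352 * M * F) (fF : Φ ≤ 1152 * M * N * F) (hΦ : SF / (1 + SF) ≤ Φ) :
    min (δ ^ 2 + ((1 + y₀ ^ 2) * x₀ ^ 2 + (x₁ * y₀ + x₂) ^ 2) / ((1 + y₀ ^ 2) + (x₁ - y₀ * x₂) ^ 2) + (y₁ ^ 2 + y₂ ^ 2) / (1 + y₀ ^ 2) + Sz + SF) 1 ≤
      10816 * (1 + N) * M * F := by
  -- the algebraic facts before abbreviating
  have hWV : (x₁ * y₀ + x₂) ^ 2 + (x₁ - y₀ * x₂) ^ 2 = (1 + y₀ ^ 2) * (x₁ ^ 2 + x₂ ^ 2) := by ring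
  have hPb : (1 + y₀ ^ 2) * x₀ ^ 2 + (x₁ * y₀ + x₂) ^ 2 - 2 * (x₁ ^ 2 + x₂ ^ 2) * (y₁ ^ 2 + y₂ ^ 2) ≤
      2 * ((x₁ * y₀ + x₂) ^ 2 + (x₂ * y₂ + x₀ * y₀) ^ 2 + (x₀ - x₁ * y₂) ^ 2) := by
    have e : 2 * ((x₁ * y₀ + x₂) ^ 2 + (x₂ * y₂ + x₀ * y₀) ^ 2 + (x₀ - x₁ * y₂) ^ 2) -
        ((1 + y₀ ^ 2) * x₀ ^ 2 + (x₁ * y₀ + x₂) ^ 2 - 2 * (x₁ ^ 2 + x₂ ^ 2) * (y₁ ^ 2 + y₂ ^ 2)) =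
        (x₁ * y₀ + x₂) ^ 2 + 2 * (x₁ ^ 2 + x₂ ^ 2) * y₁ ^ 2 + (x₀ - 2 * x₁ * y₂) ^ 2 + (2 * x₂ * y₂ + x₀ * y₀) ^ 2 := by ring
    nlinarith only [e, sq_nonneg (x₁ * y₀ + x₂), sq_nonneg (x₀ - 2 * x₁ * y₂), sq_nonneg (2 * x₂ * y₂ + x₀ * y₀),
      mul_nonneg (mul_nonneg zero_le_two (add_nonneg (sq_nonneg x₁) (sq_nonneg x₂))) (sq_nonneg y₁)]
  -- abbreviations
  set P : ℝ := (x₁ * y₀ + x₂) ^ 2 + (x₂ * y₂ + x₀ * y₀) ^ 2 + (x₀ - x₁ * y₂) ^ 2 with hP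
  have hP0 : 0 ≤ P := by rw [hP]; positivity
  set Y : ℝ := 1 + y₀ ^ 2 with hY
  set Qv : ℝ := y₁ ^ 2 + y₂ ^ 2 with hQv
  set U : ℝ := x₁ ^ 2 + x₂ ^ 2 with hU
  set W : ℝ := x₁ * y₀ + x₂ with hW
  set V : ℝ := x₁ - y₀ * x₂ with hV
  have hY1 : 1 ≤ Y := by rw [hY]; nlinarith [sq_nonneg y₀]
  have hQ0 : 0 ≤ Qv := by rw [hQv]; positivity
  have hU0 : 0 ≤ U := by rw [hU]; positivity
  have hSyQ : y₀ ^ 2 + y₁ ^ 2 + y₂ ^ 2 = (Y - 1) + Qv := by rw [hY, hQv]; ring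
  have hT' : x₀ ^ 2 + x₁ ^ 2 + x₂ ^ 2 = x₀ ^ 2 + U := by rw [hU]; ring
  rw [hSyQ] at fs2 fc
  rw [hT'] at fc
  have e1 : 1 + (Y - 1 + Qv) = Y + Qv := by ring
  rw [e1] at fs2 fc
  clear_value P Y Qv U W V
  have hY0 : 0 < Y := by linarith
  have hYQ : 0 < Y + Qv := by linarith
  have hT : 0 < 1 + (x₀ ^ 2 + U) := by nlinarith [sq_nonneg x₀]
  have hD : 0 < Y + V ^ 2 := by nlinarith [sq_nonneg V]
  have hMF : 0 ≤ M * F := by positivity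
  have hMNF : 0 ≤ M * N * F := by positivity
  have hYne : Y ≠ 0 := hY0.ne'
  have hYQne : Y + Qv ≠ 0 := hYQ.ne'
  have hTne : 1 + (x₀ ^ 2 + U) ≠ 0 := hT.ne'
  have hDne : Y + V ^ 2 ≠ 0 := hD.ne'
  -- the x-part numerator `ξn = Y x₀² + W²` and the identity `Y·T = (Y + V²) + ξn`
  have hξ0 : 0 ≤ Y * x₀ ^ 2 + W ^ 2 := by positivity
  have hYT : Y * (1 + (x₀ ^ 2 + U)) = (Y + V ^ 2) + (Y * x₀ ^ 2 + W ^ 2) := by linear_combination (-1 : ℝ) * hWV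
  -- split the two terms of `fs2`
  have hs2a : 4 * Qv / (Y + Qv) ≤ 1352 * M * F := by
    have h2 : 0 ≤ 4 * δ ^ 2 * Y / ((1 + δ ^ 2) * (Y + Qv)) := by positivity
    linarith only [fs2, h2]
  have hs2b : 4 * δ ^ 2 * Y / ((1 + δ ^ 2) * (Y + Qv)) ≤ 1352 * M * F := by
    have h2 : 0 ≤ 4 * Qv / (Y + Qv) := by positivity
    linarith only [fs2, h2]
  -- the x-part: `ξn/(T(Y+Qv)) ≤ 1352MF`
  have hx : (Y * x₀ ^ 2 + W ^ 2) / ((1 + (x₀ ^ 2 + U)) * (Y + Qv)) ≤ 1352 * M * F := by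
    -- `2P ≥ ξn − 2UQv`
    have h1 : (Y * x₀ ^ 2 + W ^ 2) / ((1 + (x₀ ^ 2 + U)) * (Y + Qv)) ≤
        (2 * P + 2 * U * Qv) / ((1 + (x₀ ^ 2 + U)) * (Y + Qv)) := div_le_div_of_nonneg_right (by linarith only [hPb]) (mul_pos hT hYQ).le
    have h2 : (2 * P + 2 * U * Qv) / ((1 + (x₀ ^ 2 + U)) * (Y + Qv)) =
        (1 / 2) * (4 * P / ((1 + (x₀ ^ 2 + U)) * (Y + Qv))) + (1 / 2) * ((U / (1 + (x₀ ^ 2 + U))) * (4 * Qv / (Y + Qv))) := by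
      field_simp; ring
    have h3 : U / (1 + (x₀ ^ 2 + U)) ≤ 1 := by rw [div_le_one hT]; linarith only [sq_nonneg x₀]
    have h4 : (U / (1 + (x₀ ^ 2 + U))) * (4 * Qv / (Y + Qv)) ≤ 1 * (4 * Qv / (Y + Qv)) := mul_le_mul_of_nonneg_right h3 (by positivity)
    linarith only [h1, h2, h4, fc, hs2a]
  -- CASE 1: `Qv ≥ Y`
  rcases le_or_gt Y Qv with hbig | hsmall
  · have h1 : (2 : ℝ) ≤ 4 * Qv / (Y + Qv) := by rw [le_div_iff₀ hYQ]; linarith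
    have h2 : min (δ ^ 2 + (Y * x₀ ^ 2 + W ^ 2) / (Y + V ^ 2) + Qv / Y + Sz + SF) 1 ≤ 1 := min_le_right _ _
    linarith only [h1, h2, hs2a, hMNF]
  -- CASE 2: `Qv < Y`
  · have hYQ2 : Y + Qv ≤ 2 * Y := by linarith
    -- δ: `frac(δ²) ≤ (1352/2)MF`
    have gδ : δ ^ 2 / (1 + δ ^ 2) ≤ 676 * (M * F) := by
      have h1 : 4 * δ ^ 2 * Y / ((1 + δ ^ 2) * (Y + Qv)) ≥ 4 * δ ^ 2 * Y / ((1 + δ ^ 2) * (2 * Y)) :=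
        div_le_div_of_nonneg_left (mul_nonneg (mul_nonneg (by norm_num) (sq_nonneg δ)) hY0.le) (mul_pos (by positivity) hYQ)
          (mul_le_mul_of_nonneg_left hYQ2 (by positivity))
      have h2 : 4 * δ ^ 2 * Y / ((1 + δ ^ 2) * (2 * Y)) = 2 * (δ ^ 2 / (1 + δ ^ 2)) := by field_simp; ring
      linarith only [h1, h2, hs2b]
    -- y⊥: `Qv/Y ≤ (1352/2)MF`
    have gQ : Qv / Y ≤ 676 * (M * F) := by
      have h1 : 4 * Qv / (Y + Qv) ≥ 4 * Qv / (2 * Y) := div_le_div_of_nonneg_left (by linarith only [hQ0]) hYQ hYQ2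
      have h2 : 4 * Qv / (2 * Y) = 2 * (Qv / Y) := by field_simp; ring
      linarith only [h1, h2, hs2a]
    -- x: `frac(ξ′²) ≤ 2·1352MF` with `ξ′² = ξn/(Y+V²)`
    have gx : ((Y * x₀ ^ 2 + W ^ 2) / (Y + V ^ 2)) / (1 + (Y * x₀ ^ 2 + W ^ 2) / (Y + V ^ 2)) ≤ 2704 * (M * F) := by
      have e : ((Y * x₀ ^ 2 + W ^ 2) / (Y + V ^ 2)) / (1 + (Y * x₀ ^ 2 + W ^ 2) / (Y + V ^ 2)) = (Y * x₀ ^ 2 + W ^ 2) / ((Y + V ^ 2) + (Y * x₀ ^ 2 + W ^ 2)) := by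
        field_simp
      rw [e, ← hYT]
      have h1 : (Y * x₀ ^ 2 + W ^ 2) / (Y * (1 + (x₀ ^ 2 + U))) ≤ (Y * x₀ ^ 2 + W ^ 2) / ((1 + (x₀ ^ 2 + U)) * ((Y + Qv) / 2)) :=
        div_le_div_of_nonneg_left hξ0 (mul_pos hT (by linarith only [hYQ])) (by nlinarith only [hYQ2, hT])
      have h2 : (Y * x₀ ^ 2 + W ^ 2) / ((1 + (x₀ ^ 2 + U)) * ((Y + Qv) / 2)) = 2 * ((Y * x₀ ^ 2 + W ^ 2) / ((1 + (x₀ ^ 2 + U)) * (Y + Qv))) := by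
        field_simp
      linarith only [h1, h2, hx]
    -- z, followers
    have gz : Sz / (1 + Sz) ≤ 1352 * (M * F) := by linarith only [fz]
    have gF : SF / (1 + SF) ≤ 1152 * (M * N * F) := by linarith only [hΦ, fF]
    -- `min ≤ Σ min ≤ Σ 2·frac`
    have hx0' : 0 ≤ (Y * x₀ ^ 2 + W ^ 2) / (Y + V ^ 2) := div_nonneg hξ0 hD.le
    have hq0' : 0 ≤ Qv / Y := div_nonneg hQ0 hY0.le
    have n2 : 0 ≤ δ ^ 2 + (Y * x₀ ^ 2 + W ^ 2) / (Y + V ^ 2) := add_nonneg (sq_nonneg δ) hx0'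
    have n3 : 0 ≤ δ ^ 2 + (Y * x₀ ^ 2 + W ^ 2) / (Y + V ^ 2) + Qv / Y := add_nonneg n2 hq0'
    have n4 : 0 ≤ δ ^ 2 + (Y * x₀ ^ 2 + W ^ 2) / (Y + V ^ 2) + Qv / Y + Sz := add_nonneg n3 hSz
    have m1 := min_add_le_add_min n4 hSF
    have m2 := min_add_le_add_min n3 hSz
    have m3 := min_add_le_add_min n2 hq0'
    have m4 := min_add_le_add_min (sq_nonneg δ) hx0'
    have f1 := bfar_min_le (δ ^ 2) (sq_nonneg δ)
    have f2 := bfar_min_le _ hx0'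
    have f3 : min (Qv / Y) 1 ≤ Qv / Y := min_le_left _ _
    have f4 := bfar_min_le Sz hSz
    have f5 := bfar_min_le SF hSF
    linarith only [m1, m2, m3, m4, f1, f2, f3, f4, f5, gδ, gQ, gx, gz, gF, hMF, hMNF]

/-! ## §2 The global floor and the far floor of sector 001 -/

/-- ★★★ **THE GLOBAL FLOOR OF SECTOR 001 IN THE TRANSLATED CHART** — EVERY hub letter `δ ∈ ℝ`, EVERY sign pattern, ALL coordinates (one region, no cut):
`min(δ² + ((1+y₀²)x₀² + w²)/((1+y₀²) + v′²) + |y⊥|²/(1+y₀²) + |z|² + Σ_f|η_f|², 1) ≤ 10816·(1+|Fol L|)·L⁶·F̂₁` with `w = x₁y₀ + x₂`, `v′ = x₁ − y₀x₂`,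
`F̂₁ = trGnoDeficit uJ z₁ (sectorChar z₁) (hubAt δ 1) ε η`. [cite: tHooft1979] [cite: Luscher1983, §2] -/
theorem tr001_global_floor (δ : ℝ) (ε : GnoSign L) (η : GnoCoord L) :
    min (δ ^ 2 + ((1 + (η.1.2 0) ^ 2) * (η.1.1 0) ^ 2 + (η.1.1 1 * η.1.2 0 + η.1.1 2) ^ 2) / ((1 + (η.1.2 0) ^ 2) + (η.1.1 1 - η.1.2 0 * η.1.1 2) ^ 2) +
        ((η.1.2 1) ^ 2 + (η.1.2 2) ^ 2) / (1 + (η.1.2 0) ^ 2) + ((η.2.1 0) ^ 2 + (η.2.1 1) ^ 2 + (η.2.1 2) ^ 2) +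
        ∑ i : Fol L, ((η.2.2 i 0) ^ 2 + (η.2.2 i 1) ^ 2 + (η.2.2 i 2) ^ 2)) 1 ≤
      10816 * (1 + (Fintype.card (Fol L) : ℝ)) * (L : ℝ) ^ 6 * trGnoDeficit uJ z₁ (sectorChar z₁) (hubAt δ 1) ε η := by
  have ha : hubAt δ 1 ≠ 0 := hubAt_one_ne_zero δ
  have hL : (0 : ℝ) < L := by exact_mod_cast NeZero.pos L
  have fs2 := trDeficit_floor_sigma2_hubAt (L := L) δ ε η
  have fc := trDeficit_floor_comm02 (L := L) ha ε η
  have fz := trDeficit_floor_z (L := L) ha ε η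
  have fF := trDeficit_floor_followers (L := L) (hubAt δ 1) ε η
  have hΦ := bfar_sum_frac_ge (fun i : Fol L => (η.2.2 i 0) ^ 2 + (η.2.2 i 1) ^ 2 + (η.2.2 i 2) ^ 2) fun i => by positivity
  exact bfar_tr_scalar (N := (Fintype.card (Fol L) : ℝ)) (pow_pos hL 6) (by positivity) (trGnoDeficit_nonneg _ _ _ _ _ _) (by positivity)
    (Finset.sum_nonneg fun i _ => by positivity) fs2 fc fz fF hΦ

/-- ★★★ **THE FAR FLOOR OF SECTOR 001** — the far-floor socket of the 001 fibred Laplace law in the rescaled letters (x-fibre letters over `√((1+y₀²)+v′²)/√(1+y₀²)`,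
`y⊥` over `√(1+y₀²)`; `δ`, `z`, followers unscaled): for `0 ≤ R ≤ 1`, if `R² ≤ δ² + ((1+y₀²)x₀² + w²)/((1+y₀²)+v′²) + |y⊥|²/(1+y₀²) + |z|² + Σ|η_f|²` then
`R²/(10816·(1+|Fol L|)·L⁶) ≤ F̂₁` — polynomial in `L` only (no cut in sector 001). [cite: tHooft1979] [cite: Luscher1983, §2] -/
theorem tr001_far_floor (δ R : ℝ) (hR0 : 0 ≤ R) (hR1 : R ≤ 1) (ε : GnoSign L) (η : GnoCoord L)
    (hfar : R ^ 2 ≤ δ ^ 2 + ((1 + (η.1.2 0) ^ 2) * (η.1.1 0) ^ 2 + (η.1.1 1 * η.1.2 0 + η.1.1 2) ^ 2) / ((1 + (η.1.2 0) ^ 2) + (η.1.1 1 - η.1.2 0 * η.1.1 2) ^ 2) +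
        ((η.1.2 1) ^ 2 + (η.1.2 2) ^ 2) / (1 + (η.1.2 0) ^ 2) + ((η.2.1 0) ^ 2 + (η.2.1 1) ^ 2 + (η.2.1 2) ^ 2) +
        ∑ i : Fol L, ((η.2.2 i 0) ^ 2 + (η.2.2 i 1) ^ 2 + (η.2.2 i 2) ^ 2)) :
    R ^ 2 / (10816 * (1 + (Fintype.card (Fol L) : ℝ)) * (L : ℝ) ^ 6) ≤ trGnoDeficit uJ z₁ (sectorChar z₁) (hubAt δ 1) ε η := by
  have h := tr001_global_floor (L := L) δ ε η
  have hL : (0 : ℝ) < L := by exact_mod_cast NeZero.pos L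
  have hR2 : R ^ 2 ≤ 1 := by nlinarith
  have hmin : R ^ 2 ≤ min (δ ^ 2 + ((1 + (η.1.2 0) ^ 2) * (η.1.1 0) ^ 2 + (η.1.1 1 * η.1.2 0 + η.1.1 2) ^ 2) /
      ((1 + (η.1.2 0) ^ 2) + (η.1.1 1 - η.1.2 0 * η.1.1 2) ^ 2) + ((η.1.2 1) ^ 2 + (η.1.2 2) ^ 2) / (1 + (η.1.2 0) ^ 2) +
      ((η.2.1 0) ^ 2 + (η.2.1 1) ^ 2 + (η.2.1 2) ^ 2) + ∑ i : Fol L, ((η.2.2 i 0) ^ 2 + (η.2.2 i 1) ^ 2 + (η.2.2 i 2) ^ 2)) 1 := le_min hfar hR2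
  rw [div_le_iff₀ (by positivity)]
  linarith

end Summit.QuantumFields.YangMills.Theorems.SwapVirialDeficit.BlowUpRing

end
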